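import Literature.MathematicalPhysics.QuantumFieldTheory.Balaban1983to89.Node00.TorusCoverBoxStencils
import Literature.MathematicalPhysics.QuantumFieldTheory.Balaban1983to89.Node00.TorusCoverCubeMemberPrint

/-!
# NODE 00 — THE WINDOW STENCILS AT THE PRINT DATUM: every plaquette ∕ bond of `T_η` has its (1.7)- ∕ (1.9)-stencil inside `π(□)` for the box `□` of the PRINT
# datum `propCubeP` (36a: corner on the `ρ`-grid, side a multiple of `ρ`, collar `ρ`) of the grid cube of its base corner (resp. base corner `− 𝟙`) — the
# `propCubeP` twin of FILE `TorusCoverBoxStencils` §2 (which served FILE 26's `propCube`), i.e. the hypothesis `p ∈ plaqInside Y` ∕ `b ∈ Sect2.bondsDeep Y` of the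
# S6 tokens at the window `Y := π '' box(propCubeP …)` of door (a)

Cell `pub-ymgap`, width seat `pub-ymgap-dag-n07-w4` gen 2 (director-ym №197 ∕ HUMAN RULING D-0149); node N07 = [15] = [Balaban1985Variational]; [6] = [Balaban1985RegularSpaces].
`--kind proof --supports stmt-QuantumFields-20542 --as helper`; count-neutral; theorems only, no `def`.  CONSUMED BY NAME, nothing restated: this seat's g0 FILE
`Node00.TorusCoverBoxStencils` §1 (`Sect2.mem_plaqInside_cover_inBox`, `Sect2.mem_bondsDeep_cover_inBox` — generic windows `[lo, hi]` with slack), n07-e's 36a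
`Node00.TorusCoverCubeMemberPrint` (`propCubeP`, `cornerP`, `sideP`, `gridFloor_le`, `lt_gridFloor_add`, `le_sideP`), r15's `cover ∕ lift ∕ cover_lift`, def-R's `cubeIdx`
(`cubeIdx_le ∕ lt_cubeIdx`), n05-a's `B8Eq131Cubes.box ∕ bLo ∕ bHi`, def-K0's `plaqInside`, 33b's `Sect2.bondsDeep`.

WHY.  Print p. 302: *«for a plaquette p, or a bond b, we take a unit cube Δ₀ ⊂ B_j(Λ_j) containing p or b.  The cube Δ₀ is contained in a big cube … and we take □ as this big
cube»*.  At door (a) of the S6 HEAD (n07-e LOCATED-TOWER, INBOX l.27663; n07-w4 l.27845) the per-cube heart of [15] Sect. F is keyed on the torus family `Node00.cubeDomains` of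
the PRINT datum `c := propCubeP P n hn M ρ hρ a` (39b `adm22_cubeDomains_propCubeP`; k0-s1-w3's collar; n07-w3's (152)∕(153) doors) with the window `Y := π '' box L c.a c.M n`;
the tokens `LocalLetters165∕167TopStep(Core)` ask `p ∈ plaqInside Y` (resp. `b ∈ Sect2.bondsDeep Y`).  FILE `TorusCoverBoxStencils` §2 proved this for FILE 26's datum
`propCube` (corner `M·a`, side `M + 11d + L`); THIS FILE proves it for `propCubeP` (corner `cornerP = ρ·⌊M·a∕ρ⌋ ≤ M·a`, side `sideP ≥ M + 11d + ρ + 1`): the box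
`[Lⁿ·cornerP, Lⁿ(cornerP + sideP) − 1]` contains `[S·a, S·a + S + 2]` coordinatewise (`S = LⁿM`; the corner moved DOWN by `< ρ`, the side grew by `≥ 11d + ρ + 1`, so the
upper slack is `≥ Lⁿ(11d + 2) − 1 ≥ 2`), which is all §1's generic lemmas need for the grid cube of the base corner (plaquettes: corners within `+𝟙`) resp. of the base
corner `− 𝟙` (bonds: stencil `[x − 𝟙, x + 2·𝟙]`).

CONTENTS.  `Sect2.bLo_propCubeP_le` · `Sect2.le_bHi_propCubeP` (the two coordinate bounds) · ★ `Sect2.mem_plaqInside_cover_box_propCubeP` · ★ `Sect2.mem_bondsDeep_cover_box_propCubeP`.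

HONEST FRAMING: integer bookkeeping on box coordinates; nothing of [15]∕[6] asserted; tokens NOT discharged; stub 1 ∕ K0⁷ ∕ K1⁷ NOT closed; N07 NOT discharged; counts unmoved (typed
28∕28 · discharged 5∕27); one finite 𝕋⁴ programme at fixed ε — R4 closes the conditional finite-𝕋⁴ rung `BalabanLadder.UV` ONLY; the YM mass gap (Clay) is NOT proved by any of
this; nothing continuum ∕ ℝ⁴ ∕ OS.  No `def`, no `instance`, no `notation`, no `sorry`.
-/

noncomputable section

namespace Literature.MathematicalPhysics.QuantumFieldTheory.Balaban1983to89.Node00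

open B15Eq112TorusCover (cover lift cover_lift)
open B14DomainGeom (Pt cubeIdx cubeIdx_le lt_cubeIdx)
open B14.Eq213MaximalDomains (side)
open B7Prop1Local (InBox)
open B8Eq131Cubes (box bLo bHi)

variable {P : Params}

/-- **THE PRINT BOX STARTS AT OR BELOW THE GRID CUBE**: `Lⁿ·cornerP_i ≤ S·a_i` (`S = LⁿM`; `cornerP = ρ⌊M·a∕ρ⌋ ≤ M·a`).
[cite: Balaban1985RegularSpaces, p.98 («□_j is a sum of the big blocks»; bookkeeping)] -/
theorem Sect2.bLo_propCubeP_le {n : ℕ} (hn : 1 ≤ n) (M : ℕ) {ρ : ℕ} (hρ : P.L ≤ ρ) (a : Pt P.d) (i : Fin P.d) :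
    bLo P.L (propCubeP P n hn M ρ hρ a).a n 0 i ≤ ((side P.L M n : ℕ) : ℤ) * a i := by
  have hρ0 : 0 < ρ := lt_of_lt_of_le P.L_pos hρ
  have hc : cornerP P M ρ a i ≤ (M : ℤ) * a i := gridFloor_le hρ0 _
  have hL0 : (0 : ℤ) ≤ (P.L : ℤ) ^ n := by positivity
  simp only [bLo, propCubeP_a, side]
  push_cast
  nlinarith

/-- **THE PRINT BOX ENDS AT LEAST `2` ABOVE THE NEXT GRID CUBE**: `S·a_i + S + 2 ≤ Lⁿ(cornerP_i + sideP) − 1` (`cornerP > M·a − ρ`, `sideP ≥ M + 11d + ρ + 1`, so the slack above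
the grid cube `[S·a, S·a + S − 1]` is `≥ Lⁿ(11d + 2) − 1 ≥ 3`). [cite: Balaban1985RegularSpaces, p.98, (1.130) p.99 («11d < M»; bookkeeping)] -/
theorem Sect2.le_bHi_propCubeP {n : ℕ} (hn : 1 ≤ n) (M : ℕ) {ρ : ℕ} (hρ : P.L ≤ ρ) (a : Pt P.d) (i : Fin P.d) :
    ((side P.L M n : ℕ) : ℤ) * a i + (side P.L M n : ℕ) + 2 ≤ bHi P.L (propCubeP P n hn M ρ hρ a).a (propCubeP P n hn M ρ hρ a).M n 0 i := by
  have hρ0 : 0 < ρ := lt_of_lt_of_le P.L_pos hρ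
  have hc : (M : ℤ) * a i < cornerP P M ρ a i + ρ := lt_gridFloor_add hρ0 _
  have hs : ((M + 11 * P.d + ρ + 1 : ℕ) : ℤ) ≤ ((sideP P M ρ : ℕ) : ℤ) := by exact_mod_cast le_sideP (P := P) M hρ0
  have hL1 : (1 : ℤ) ≤ (P.L : ℤ) ^ n := one_le_pow₀ (by exact_mod_cast P.L_pos)
  have hd : (1 : ℤ) ≤ P.d := by exact_mod_cast P.hd
  simp only [bHi, propCubeP_a, propCubeP_M, side]
  push_cast at hs ⊢
  -- `cornerP + sideP ≥ M·a + M + 11d + 2` (integers), then multiply by `Lⁿ ≥ 1`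
  have h1 : (M : ℤ) * a i + M + 11 * (P.d : ℤ) + 2 ≤ cornerP P M ρ a i + (sideP P M ρ : ℤ) := by linarith
  have h2 : (P.L : ℤ) ^ n * ((M : ℤ) * a i + M + 11 * (P.d : ℤ) + 2) ≤ (P.L : ℤ) ^ n * (cornerP P M ρ a i + (sideP P M ρ : ℤ)) :=
    mul_le_mul_of_nonneg_left h1 (by linarith)
  have h3 : (3 : ℤ) ≤ (P.L : ℤ) ^ n * (11 * (P.d : ℤ) + 2) := by nlinarith
  nlinarith

/-- ★ **EVERY PLAQUETTE LIES IN `plaqInside π(□)` FOR THE PRINT DATUM OF THE GRID CUBE OF ITS BASE CORNER**: with `x = lift p₋`, `S = LⁿM`, `a = cubeIdx S x` (so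
`S·a ≤ x < S·a + S`), all four corners of `p` lie in `π(box L (propCubeP n M ρ a).a (propCubeP …).M n)` (slack `≥ 2` above the grid cube, §0).
[cite: Balaban1985Variational, p.302 («a unit cube Δ₀ … containing p … we take □ as this big cube»); Balaban1985RegularSpaces, (1.7) p.77; Balaban1988Convergent, (2.17) p.257] -/
theorem Sect2.mem_plaqInside_cover_box_propCubeP (p : Plaq P 0) {n : ℕ} (hn : 1 ≤ n) {M : ℕ} (hM : 1 ≤ M) {ρ : ℕ} (hρ : P.L ≤ ρ) :
    p ∈ plaqInside (cover P '' box P.L (propCubeP P n hn M ρ hρ (cubeIdx (side P.L M n) (lift P p.src))).a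
      (propCubeP P n hn M ρ hρ (cubeIdx (side P.L M n) (lift P p.src))).M n) := by
  set S := side P.L M n with hS
  set x := lift P p.src with hx
  set a := cubeIdx S x with ha
  have hSpos : 0 < S := B14.Eq213MaximalDomains.side_pos P.L_pos hM n
  have hlo := fun i => Sect2.bLo_propCubeP_le (P := P) hn M hρ a i
  have hhi := fun i => Sect2.le_bHi_propCubeP (P := P) hn M hρ a i
  show p ∈ plaqInside (cover P '' {z | InBox (bLo P.L (propCubeP P n hn M ρ hρ a).a n 0) (bHi P.L (propCubeP P n hn M ρ hρ a).a (propCubeP P n hn M ρ hρ a).M n 0) z})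
  refine Sect2.mem_plaqInside_cover_inBox (x := x) (fun i => ⟨?_, ?_⟩) (fun i => ?_) p (by rw [hx, cover_lift])
  · have := cubeIdx_le S hSpos x i; linarith [hlo i]
  · have := lt_cubeIdx S hSpos x i; linarith [hhi i]
  · have := lt_cubeIdx S hSpos x i; linarith [hhi i]

/-- ★ **EVERY BOND IS DEEP IN `π(□)` FOR THE PRINT DATUM OF THE GRID CUBE OF ITS BASE CORNER `− 𝟙`**: with `x = lift b₋`, `a = cubeIdx S (x − 𝟙)`, the (1.9)-stencil
`[x − 𝟙, x + 2·𝟙]` of `b` (both end-points and all their nearest neighbours, 33b's `Sect2.bondsDeep`) lies in `π(box L (propCubeP n M ρ a).a (propCubeP …).M n)`.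
[cite: Balaban1985Variational, p.302 («… or a bond b»); Balaban1985RegularSpaces, (1.9) p.77, (1.2) p.76] -/
theorem Sect2.mem_bondsDeep_cover_box_propCubeP (b : PBond P 0) {n : ℕ} (hn : 1 ≤ n) {M : ℕ} (hM : 1 ≤ M) {ρ : ℕ} (hρ : P.L ≤ ρ) :
    b ∈ Sect2.bondsDeep (cover P '' box P.L (propCubeP P n hn M ρ hρ (cubeIdx (side P.L M n) (lift P b.src - fun _ => 1))).a
      (propCubeP P n hn M ρ hρ (cubeIdx (side P.L M n) (lift P b.src - fun _ => 1))).M n) := by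
  set S := side P.L M n with hS
  set x := lift P b.src with hx
  set a := cubeIdx S (x - fun _ => 1) with ha
  have hSpos : 0 < S := B14.Eq213MaximalDomains.side_pos P.L_pos hM n
  have hlo := fun i => Sect2.bLo_propCubeP_le (P := P) hn M hρ a i
  have hhi := fun i => Sect2.le_bHi_propCubeP (P := P) hn M hρ a i
  show b ∈ Sect2.bondsDeep (cover P '' {z | InBox (bLo P.L (propCubeP P n hn M ρ hρ a).a n 0) (bHi P.L (propCubeP P n hn M ρ hρ a).a (propCubeP P n hn M ρ hρ a).M n 0) z})
  refine Sect2.mem_bondsDeep_cover_inBox (x := x) (fun i => ?_) (fun i => ?_) b (by rw [hx, cover_lift])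
  · have h := cubeIdx_le S hSpos (x - fun _ => 1) i
    simp only [Pi.sub_apply] at h
    linarith [hlo i]
  · have h := lt_cubeIdx S hSpos (x - fun _ => 1) i
    simp only [Pi.sub_apply] at h
    linarith [hhi i]

end Literature.MathematicalPhysics.QuantumFieldTheory.Balaban1983to89.Node00

end
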